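import Literature.MathematicalPhysics.QuantumFieldTheory.Balaban1983to89.B9Eq327GreenZdHerm

/-!
# `Balaban1983to89.B9SupplySockB9P3ZdAtHermInAk` — [Balaban1985BackgroundPropagators] (3.27) p. 395 ∕ [Balaban1985RegularSpaces] (1.58) p. 86, (1.7) p. 77:
# EDITION H·I OF THE JUNCTION'S (3.27) BINDER — `InvAtHI`, (3.27) on the Hermitian fields of `E(Ω₀)` KEYED BY THE DATUM'S OWN CLASS `𝔄_m({Ω_j}, α₀)`
# (`B8Ineq132.InAk`) instead of the frame's class (3.35) (`bg.Reg335`) — and the β∕γ·InAk collar-socket member supplier + families re-proved VERBATIM on it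
# (`sockB9P3D4γIHI_at`, threshold gains the entry `aI`)

statement-level skeleton of published theorems with citation tags; proofs where landed; nothing here is a claim about the
Yang–Mills mass gap

`[Balaban1985BackgroundPropagators]` ("B9", CMP **99** (1985) 389–434; journal page = PDF page + 388): (3.27) p. 395 (`G(U) = (Ω₀Δ_aΩ₀)⁻¹`), Thm 3.11
p. 416, (3.35) p. 396, Thm 3.3 p. 399, (3.47) p. 398, (3.69) p. 404.  `[Balaban1985RegularSpaces]` ("B8", CMP **99** (1985) 75–102): (1.7) p. 77 (the class
`𝔄_k({Ω_j}, α₀)` — «|U(∂p) − 1| < α₀L^{−2j} for p ∈ Ω_j», p ∈ Ω_j in the TOUCHING convention of p. 77), (1.33) p. 82 («U₀ ∈ 𝔄_k({Ω_j}, α₀)» is the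
hypothesis under which Prop. 6 and (1.58) are used), (1.58)–(1.59) p. 86, Prop. 3 p. 87, (1.31) p. 82.  `[Balaban1984PropagatorsII]` (2.3) p. 224.

CITATION HEADER ∕ WHY THIS FILE (cell `pub-ymgap`, HUMAN RULING D-0062; seat `pub-ymgap-dag-n06-b` (g20), the binder∕letter owner of the junction
J-N06→N05).  LOCATED-SELF-6 (this seat, g20): at a `cubeFam false` member the frame's class `(bgZd 𝔸 L (memZd M i m)).Reg335 c35 α₀` (r05's `Reg335Zd` on
the cubes `cubeClass396Zd ⊆ OmTrunc ⊆ Ω₀ = □₀`) cannot see the COLLAR plaquettes — based outside `□₀`, touching it — which the genuine `Δ_a(U₀)↾E(□₀)` of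
`opsAllZd` reads (`B9Eq326DeltaALocalityZdSides`); so a `Reg335`-keyed (3.27) binder (`InvAt`, `InvAtH`) asks the genuine `G_𝔤(U₀)` to exist at
backgrounds print never feeds to (3.27).  Print's hypothesis at the point of use is [B8] (1.33)∕(1.58): «U₀ ∈ 𝔄_k({Ω_j}, α₀)» — and the socket DATUM of
the member suppliers carries exactly `hInAk : InAk L m i.η α₀ i.Ω U₀`.  THIS FILE re-keys the binder to that hypothesis (the offer this lineage made at
EDITION γ·InAk for `CurvAt`, g16): `InvAtHI L ops aI M i m` = `InvAtH` with the frame line replaced by `α₀ ≤ aI ∧ InAk L m i.η α₀ i.Ω U₀` (no frame, no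
`c35`, no `M·α₀ ≤ a₃` guard), and re-proves the β∕γ·InAk collar-socket member supplier and its two family forms VERBATIM with one more threshold entry
`aI`: `cP = min{1∕16, c₆∕M, a₀∕(K₆M), a₃∕(K₆M), aI, 1∕(2B₀c₆₉M+1)}`.  The companion `B9Thm311InvAtHIWitnessCubeZd` (g20) INHABITS `InvAtHI` for
`withGopZdH (opsAllZd τ L (cubeLamBP …) ops₀)` at every cube member and every `m ≤ k` with a member-dependent `aI > 0` — the first `m ≥ 1` witness of the
junction's (3.27) slot for the genuine `G_𝔤`.

WHAT IS DEFINED ∕ PROVED (1 def + 5 thm; no `sorry`, no `instance`, no `notation`).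
* §1 ★ `InvAtHI L ops aI M i m` (the binder), `invAtHI_anti` (antitone in `aI`), `invAtHI_of_forall` (from a frame-free «∀ unitary U₀ ∈ 𝔄_m(α₀), α₀ ≤ aI»
  regularity statement in the shape the companion proves).
* §2 ★★ `sockB9P3D4γIHI_at` (= `B9SupplySockB9P3ZdAtHerm.sockB9P3D4γIH_at` with `hinv : InvAtHI L ops aI M i m`; proof VERBATIM except the one (3.27) call,
  now fed `hInAk` and `α₀ ≤ aI`; conclusion `SockB9P3D4β L B₀′ B_∂ cP′ i.η m i.Ω i.Λs ΛbP` with `cP′ = min{1∕16, c₆∕M, a₀∕(K₆M), a₃∕(K₆M), aI, 1∕(2B₀c₆₉M+1)}`),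
  ★ `sockB9P3D4γIHI_allLevels_of_thm33_on`, ★ `sockB9P3D4γIHI_allLevels_explicit_on` (family forms, one `aI` across the index map — uniform in the members
  exactly when the (3.27) witness is; the companion's witness is per member).

HONEST SCOPE.  A re-keying of one hypothesis + verbatim re-proofs; no new estimate; the binders `DictAt`, `Prop6At`, `LandauAt` keep their frame keys;
count-neutral helper of K1⁷ (`--supports stmt-QuantumFields-20542`); N05∕N06 NOT discharged; one finite `𝕋⁴` programme at fixed `ε`, Bałaban as printed;
R4 closes only the conditional finite-`𝕋⁴` rung `BalabanLadder.UV` — nothing continuum ∕ `ℝ⁴` ∕ OS ∕ mass gap ∕ Clay.  Unit `pub-ymgap-dag-n06-b` (g20),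
2026-08-28.
-/

noncomputable section

open NormedSpace

namespace Literature.MathematicalPhysics.QuantumFieldTheory.Balaban1983to89.B9SupplySockB9P3ZdAtHermInAk
open Complex (I)
open MatrixLog B7Prop1Explicit B7Prop2Explicit B7Prop1Local B7Eq92Concrete
open B7Prop4GeneralLevels (linCovIter)
open B7Eq78Linearization (conjR)
open B8Ineq132 (covDerivFwd covDeriv InAk BondTouches)
open B8Eq119TwistedAxial (Restr129 InAx)
open B8Eq184Proof (cfgExp)
open B8Lemma1NonAbelian (mulCfg)
open B8Eq140Level (SideTouches)
open B8Eq146AExpansion (iEta plaqCovDeriv)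
open B8Eq143PlaqExpansion (pdiv)
open B8Eq155JBound (Jcur wsup)
open B8ScaledSupNorm (bondNorm msup weight Bdd)
open B8Eq138LandauZd (IsLandau138 IsLandau138W IsLandau146 IsLandau146W InR138 QT covDivB logCfg covLap)
open B8LanF146 (LanF146)
open B8LeafModelZd (ZdIdx)
open B8LeafModelZd3 (SockB9P3)
open B9Eq340HolderZd (hquot AdmPair trans)
open B9SupplySockB9P3ZdLetters (OpsZd deltaAOf DictGlob Prop6Feed HolderGlob)
open B9SupplySockB9P3ZdLettersOmega (OnDom restrictDom outerPart Margin2 InvOnDom CurvSmallDom LandauKillsDom AvgBoundDom SockB9P3D4)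
open B9SupplySockB9P3ZdOmega (collar_arith)
open B9SupplySockB9P3ZdSrc (GopAdd SourceTermDom SourceHolderDom msup_eq_zero_of_not_bdd msup_le_add_of_norm_le hquot_add_le hquot_sub_le trans_add
  apriori_arith_src)
open B9SupplySockB9P3ZdAt (DictAt Prop6At InvAt CurvAt LandauAt AvgAt HolderAt GopAddAt SrcAt SrcHolderAt)
open B9SupplySockB9P3ZdAtLin (LinBddAt)
open B9SupplySockB9P3ZdUnivWitness (BddF)
open B9SupplySockB9P3ZdGammaUniv (AvgAtP)
open B9SupplySockB9P3ZdGammaInAk (CurvAtInAk)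
open B8Prop3GaugeFixedKLevel (mem_unitaryUnits_of_mgauge_eq mulCfg_eq_gaugeAct_of_mgauge_eq)
open B9SupplySockB9P3ZdGammaUnivDelta (HolderAtδ)
open B9SupplySockB9P3ZdGammaUnivDelta2 (HolderAtδ2 SockB9P3H2)

-- `Site` alone could resolve to the torus sites of `Setup.lean`; re-export the `ℤ^d` sites of `B7Prop1Explicit`.
export B7Prop1Explicit (Site)
open B7Prop1Explicit (e U1)
open B7Prop1Local (InBox loK bondHiK)
open B7Prop2Explicit (unitaryUnits unitaryUnits_le_U1)
open B8Eq138LandauZd (IsLandau138 IsLandau138W QT covDivB logCfg covLap)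
open B9SupplySockB9P3ZdLetters (OpsZd deltaAOf)
open B9SupplySockB9P3ZdLettersOmega (OnDom restrictDom outerPart Margin2 restrictDom_of)
open B9SupplySockB9P3ZdAt (DictAt Prop6At InvAt CurvAt LandauAt)
open B9SupplySockB9P3ZdBeta (CrossB SockB9P3D4β AvgAtβ)
open B8Eq131CubesAdmissible (cubeFam cubeFam_false_zero)
open B8Eq131Cubes (cube sqLo sqHi cube_anti)
open B8CubeMemberZd (cubeLamB)
open B8Ineq159FlatCubeMemberPrinted (cubeLamBP cubeLamBP_box_subset_pred cubeLamBP_zero_bondTouches)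
open B9SupplySockB9P3ZdGamma (SeesDom AvgAtγ wsupB1γ_restrictDom seesDom_zero_of_touch seesDom_cubeLamBP cubeLamBP' seesDom_cubeLamBP'
  mem_cubeLamBP_zero_of_bondTouches mem_cubeLamBP'_zero_of_inner cubeLamBP'_zero_bondTouches)

open B9SupplySockB9P3ZdAtHerm (InvAtH isSelfAdjoint_restrictDom)

variable {d : ℕ} {𝔸 : Type*} [CStarAlgebra 𝔸]

/-! ## §1 The binder `InvAtHI`: (3.27) on the Hermitian fields of `E(Ω₀)`, keyed by the datum's class (1.7) -/

section Binder

variable (L : ℕ)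

/-- ★ **(3.27) ON THE HERMITIAN FIELDS OF E(Ω₀), AT ONE MEMBER, FOR THE DATA OF THE JUNCTION** — `B9SupplySockB9P3ZdAtHerm.InvAtH` with the frame line
«`U₀` in the member's class (3.35), `0 < α₀`, `Mα₀ ≤ a₃`» REPLACED by the datum's own class: for every `α₀ ≤ aI`, every unitary `U₀ ∈ 𝔄_m({Ω_j}, α₀)`
(`B8Ineq132.InAk L m i.η α₀ i.Ω U₀`: small plaquette variables and small `D*∂U` on the plaquettes ∕ bonds TOUCHING the `Ω_j`, p. 77), every HERMITIAN
`A ∈ E(Ω₀)` and every `J` agreeing with `Δ_a(U₀)A` on the bonds of `Ω₀`: `G(U₀)J = A`.  Print's hypothesis at the point of use ([B8] (1.33), (1.58)) is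
exactly «U₀ ∈ 𝔄_k({Ω_j}, α₀)». [cite: Balaban1985BackgroundPropagators, (3.27) p.395, Thm 3.11 p.416, p.391; Balaban1985RegularSpaces, (1.7) p.77, (1.33) p.82, (1.58) p.86] -/
def InvAtHI (ops : ℝ → ZdIdx d L → ℕ → OpsZd d 𝔸) (aI : ℝ) (M : ℝ) (i : ZdIdx d L) (m : ℕ) : Prop :=
  ∀ (α₀ : ℝ) (U₀ : Site d → Fin d → 𝔸ˣ), (∀ x κ, U₀ x κ ∈ unitaryUnits 𝔸) → α₀ ≤ aI → InAk L m i.η α₀ i.Ω U₀ →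
    ∀ A : Site d → Fin d → 𝔸, OnDom L m i.η i.Ω A → (∀ (y : Site d) (τ : Fin d), IsSelfAdjoint (A y τ)) →
      ∀ J : Site d → Fin d → 𝔸, (∀ (y : Site d) (τ : Fin d), BondTouches (i.Ω 0) y τ → J y τ = deltaAOf i.η (ops M i m) U₀ A y τ) →
        (ops M i m).Gop U₀ J = A

/-- `InvAtHI` is antitone in the threshold `aI`. [cite: Balaban1985RegularSpaces, (1.7) p.77 (bookkeeping)] -/
theorem invAtHI_anti {ops : ℝ → ZdIdx d L → ℕ → OpsZd d 𝔸} {aI aI' : ℝ} (h : aI' ≤ aI) {M : ℝ} {i : ZdIdx d L} {m : ℕ}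
    (hI : InvAtHI L ops aI M i m) : InvAtHI L ops aI' M i m :=
  fun α₀ U₀ hU₀ hα hIn A hA hsa J hJ => hI α₀ U₀ hU₀ (hα.trans h) hIn A hA hsa J hJ

/-- **`InvAtHI` FROM A FRAME-FREE (3.27) STATEMENT ON `E_𝔤(Ω₀)`** — the shape the companion `B9Thm311InvAtHIWitnessCubeZd` proves for the genuine record: if for
every `α₀ ≤ aI` and every unitary `U₀ ∈ 𝔄_m({Ω_j}, α₀)`, `G(U₀)J = A` whenever `A ∈ E_𝔤(Ω₀)` (`B9Eq327GreenZdHerm.domSubH`) and `J = Δ_a(U₀)A` on the bonds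
of `Ω₀`, then `InvAtHI`. [cite: Balaban1985BackgroundPropagators, (3.27) p.395; Balaban1985RegularSpaces, (1.58) p.86] -/
theorem invAtHI_of_forall {ops : ℝ → ZdIdx d L → ℕ → OpsZd d 𝔸} {aI M : ℝ} {i : ZdIdx d L} {m : ℕ}
    (h : ∀ (α₀ : ℝ), α₀ ≤ aI → ∀ (U₀ : Site d → Fin d → 𝔸ˣ), (∀ x κ, U₀ x κ ∈ unitaryUnits 𝔸) → InAk L m i.η α₀ i.Ω U₀ →
      ∀ A ∈ B9Eq327GreenZdHerm.domSubH (𝔸 := 𝔸) (i.Ω 0), ∀ J : Site d → Fin d → 𝔸,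
        (∀ (y : Site d) (τ : Fin d), BondTouches (i.Ω 0) y τ → J y τ = deltaAOf i.η (ops M i m) U₀ A y τ) → (ops M i m).Gop U₀ J = A) :
    InvAtHI L ops aI M i m :=
  fun α₀ U₀ hU₀ hα hIn A hA hsa J hJ => h α₀ hα U₀ hU₀ hIn A (B9Eq327GreenZdHerm.mem_domSubH_of_onDom hA hsa) J hJ

end Binder

/-! ## §2 The cube ∕ γ·InAk road on `InvAtHI`: `sockB9P3D4γIHI_at` -/

section SupplyCubeI

variable [Nontrivial 𝔸]
variable {I : Type} (geo : I → B9.Geometry) (bg : I → B9.Backgrounds) (GA : ∀ i, B9.KernelFamily (geo i) (bg i))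
variable (L : ℕ) (mem : ℝ → ZdIdx d L → ℕ → I)
variable (ιCfg : ∀ (M : ℝ) (i : ZdIdx d L) (m : ℕ) (U₀ : Site d → Fin d → 𝔸ˣ),
  (∀ x κ, U₀ x κ ∈ unitaryUnits 𝔸) → (bg (mem M i m)).Cfg)
variable (ιLoc : ∀ (M : ℝ) (i : ZdIdx d L) (m : ℕ), (Site d → Fin d → 𝔸) → (geo (mem M i m)).Loc)
variable (ops : ℝ → ZdIdx d L → ℕ → OpsZd d 𝔸)

/-- ★★ (EDITION H·I — `hinv : InvAtHI`, (3.27) keyed by the DATUM's class (1.7) and fed `hInAk`, `α₀ ≤ aI`; threshold gains the entry `aI`.) **(Δ′-BINDER IN THE 𝔄-CURRENCY: `CurvAtInAk`; threshold without `K₆` in its last entry.)  THEOREM 3.3 FOR G(U₀) AT ONE MEMBER WITH `Margin2`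
SUPPLIES THE β COLLAR SOCKET AT ANY DATUM CLASS `ΛbP` THAT IS READ INSIDE `Ω₀`** — `B9SupplySockB9P3ZdGamma.sockB9P3D4γ_at` re-proved VERBATIM with the Δ′
bound taken at the datum's own `α₀` from `InAk` and (3.27) keyed by `InAk` (so `cP = min{1∕16, c₆∕M, a₀∕(K₆M), a₃∕(K₆M), aI, 1∕(2B₀c₆₉M+1)}`); otherwise:
`B9SupplySockB9P3ZdBeta.sockB9P3D4β_at` re-proved VERBATIM with the averaging datum class an explicit PARAMETER `ΛbP` (binder `AvgAtγ … ΛbP`, socket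
`SockB9P3D4β … ΛbP`) instead of the member's law field `i.Λb`, under the locality law `SeesDom L m (i.Ω 0) ΛbP` (which replaces the internal use of
`ZdIdx.hbox`; the hypothesis `m ≤ i.k` of the β form is therefore not needed); same constants B₀′ = max{1, 2B₀max{1,q}}, B_∂ = (20d+2)B₀′,
cP = min{1∕16, c₆∕M, a₀∕(K₆M), a₃∕(K₆M), 1∕(2B₀c₆₉K₆M+1)} (B8 p. 86 «Theorem 3.3 of [4] implies the bounds (1.59)», on E(Ω₀), with the Δ′-transfer and the
collar bookkeeping).  At `ΛbP :=` print's class [B6] (2.3) ∕ (1.31) (inner AND crossing bonds — at the cube member `B8Ineq159FlatCubeMemberPrinted.cubeLamBP`,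
law by `seesDom_cubeLamBP`) this is EDITION γ of the junction's member supplier.
[cite: Balaban1985RegularSpaces, (1.58)–(1.59) p.86, (1.31) p.82, Prop. 3 p.87, p.77; Balaban1985BackgroundPropagators, Thm 3.3 p.399, (3.26)–(3.27) p.395, (3.47) p.398, (3.69) p.404; Balaban1984PropagatorsII, (2.3) p.224] -/
theorem sockB9P3D4γIHI_at (hd2 : 2 ≤ d) (hL : 1 ≤ L) {c35 c₆ K₆ a₃ c69 q : ℝ}
    {M : ℝ} (hM1 : 1 ≤ M) (i : ZdIdx d L) (hMi : Margin2 i.Ω) {m : ℕ}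
    (hdict : DictAt geo bg GA L mem ιCfg ιLoc ops M i m) (hP6 : Prop6At bg L mem ιCfg c35 c₆ K₆ M i m)
    {aI : ℝ} (hinv : InvAtHI L ops aI M i m) (hcurv : CurvAtInAk L ops c69 M i m)
    (hlan : LandauAt bg L mem ιCfg ops c35 a₃ M i m)
    (ΛbP : ℕ → ℕ → Set (Site d × Fin d)) (havg : AvgAtγ L ops q ΛbP M i m) (hsee : SeesDom L m (i.Ω 0) ΛbP)
    (hK₆ : 0 < K₆) (hc69 : 0 ≤ c69) (hq : 0 ≤ q)
    {B₀ δ₀ a₀ : ℝ} (hB₀ : 0 < B₀)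
    (h33U : ∀ (α₀ : ℝ) (U₀ : Site d → Fin d → 𝔸ˣ) (hU₀ : ∀ x κ, U₀ x κ ∈ unitaryUnits 𝔸), 0 < α₀ → M * α₀ ≤ a₀ →
      (bg (mem M i m)).Reg335 c35 α₀ (ιCfg M i m U₀ hU₀) →
      B9.Ineq342_346_347 (GA (mem M i m)) B₀ δ₀ (ιCfg M i m U₀ hU₀)) :
    SockB9P3D4β (𝔸 := 𝔸) L (max 1 (2 * B₀ * max 1 q)) ((20 * d + 2) * max 1 (2 * B₀ * max 1 q))
      (min (1 / 16) (min (c₆ / M) (min (a₀ / (K₆ * M)) (min (a₃ / (K₆ * M)) (min aI (1 / (2 * B₀ * c69 * M + 1)))))))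
      i.η m i.Ω i.Λs ΛbP := by
  intro α₀ α₂ hα₀ hα₀c hα₂ hα₂c U₀ W hU₀ hWu hInA _ hLanW A' hsa h41 hA0
  -- the thresholds
  have hη : 0 < i.η := i.hη
  have hLr : (1 : ℝ) ≤ L := by exact_mod_cast hL
  have hd1 : (1 : ℝ) ≤ d := by exact_mod_cast (le_trans (by norm_num) hd2 : 1 ≤ d)
  have hM0 : 0 < M := lt_of_lt_of_le one_pos hM1
  have hKM : 0 < K₆ * M := mul_pos hK₆ hM0
  simp only [le_min_iff] at hα₀c hα₂c
  obtain ⟨-, hα₀c6, hα₀a0, hα₀a3, hα₀I, hα₀θ⟩ := hα₀c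
  obtain ⟨hα₂16, -, -, -, -, -⟩ := hα₂c
  have hc6 : M * α₀ ≤ c₆ := by rw [mul_comm]; exact (le_div_iff₀ hM0).1 hα₀c6
  have ha₉0 : 0 < K₆ * α₀ := mul_pos hK₆ hα₀
  have ha0' : M * (K₆ * α₀) ≤ a₀ := by
    have h := (le_div_iff₀ hKM).1 hα₀a0
    calc M * (K₆ * α₀) = α₀ * (K₆ * M) := by ring
      _ ≤ a₀ := h
  have ha3' : M * (K₆ * α₀) ≤ a₃ := by
    have h := (le_div_iff₀ hKM).1 hα₀a3
    calc M * (K₆ * α₀) = α₀ * (K₆ * M) := by ring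
      _ ≤ a₃ := h
  have hκ' : 0 ≤ c69 * M * α₀ := by positivity
  have hθ : B₀ * (c69 * M * α₀) ≤ 1 / 2 := by
    have hpos : 0 < 2 * B₀ * c69 * M + 1 := by positivity
    have h1 : α₀ * (2 * B₀ * c69 * M + 1) ≤ 1 := (le_div_iff₀ hpos).1 hα₀θ
    linarith [hα₀.le]
  -- (3.35) for U₀ by Proposition 6, and Theorem 3.3's (3.42)–(3.47) block for G(U₀)
  have hreg : (bg (mem M i m)).Reg335 c35 (K₆ * α₀) (ιCfg M i m U₀ hU₀) := hP6 α₀ U₀ hU₀ hα₀ hc6 hInA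
  have h347 := h33U (K₆ * α₀) U₀ hU₀ ha₉0 ha0' hreg
  obtain ⟨-, hd⟩ := hdict
  have hU₀1 : ∀ x κ, U₀ x κ ∈ U1 𝔸 := fun x κ => unitaryUnits_le_U1 (hU₀ x κ)
  -- the datum and its restriction to the Ω₀-bonds
  have hAglob : ∀ (y : Site d) (τ : Fin d), ‖A' y τ‖ ≤ α₂ * i.η⁻¹ := by
    intro y τ
    by_cases hmem : ∃ j, j ≤ m ∧ SideTouches (i.Ω j) y τ
    · obtain ⟨j, hj, hs⟩ := hmem
      have hLj : (1 : ℝ) ≤ (L : ℝ) ^ j := one_le_pow₀ hLr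
      calc ‖A' y τ‖ ≤ α₂ * ((L : ℝ) ^ j * i.η)⁻¹ := (h41 j hj y τ hs).2
        _ = α₂ * i.η⁻¹ * ((L : ℝ) ^ j)⁻¹ := by rw [mul_inv]; ring
        _ ≤ α₂ * i.η⁻¹ * 1 := by
            apply mul_le_mul_of_nonneg_left (inv_le_one_of_one_le₀ hLj) (by positivity)
        _ = α₂ * i.η⁻¹ := mul_one _
    · rw [hA0 y τ fun j hj hs => hmem ⟨j, hj, hs⟩, norm_zero]
      positivity
  have hAbd : Bdd L m i.η (-(1 : ℝ)) (fun j (b : Site d × Fin d) => SideTouches (i.Ω j) b.1 b.2) (fun b => A' b.1 b.2) := by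
    have e1 : (-(1 : ℝ)) = -((1 : ℕ) : ℝ) := by norm_num
    rw [e1]
    refine B8ScaledSupNorm.bdd_of_forall (c := α₂) fun j hj b hb => ?_
    rw [B8ScaledSupNorm.weight_neg_natCast, pow_one]
    have h := (h41 j hj b.1 b.2 hb).2
    have hs : 0 < (L : ℝ) ^ j * i.η := B8ScaledSupNorm.scale_pos hL hη j
    calc (L : ℝ) ^ j * i.η * ‖A' b.1 b.2‖ ≤ (L : ℝ) ^ j * i.η * (α₂ * ((L : ℝ) ^ j * i.η)⁻¹) :=
          mul_le_mul_of_nonneg_left h hs.le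
      _ = α₂ := by rw [mul_comm α₂, ← mul_assoc, mul_inv_cancel₀ hs.ne', one_mul]
  obtain ⟨Ain, hAin_def⟩ : ∃ Ain : Site d → Fin d → 𝔸, Ain = restrictDom (i.Ω 0) A' := ⟨_, rfl⟩
  have h41b : ∀ j, j ≤ m → ∀ (y : Site d) (τ : Fin d), SideTouches (i.Ω j) y τ → ‖A' y τ‖ ≤ α₂ * ((L : ℝ) ^ j * i.η)⁻¹ :=
    fun j hj y τ hs => (h41 j hj y τ hs).2
  have hOn : OnDom L m i.η i.Ω Ain := by
    rw [hAin_def]; exact B9SupplySockB9P3ZdLettersOmega.onDom_restrictDom hL hη h41b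
  have hAin_glob : ∀ (y : Site d) (τ : Fin d), ‖Ain y τ‖ ≤ α₂ * i.η⁻¹ := fun y τ => by
    rw [hAin_def]; exact (B9SupplySockB9P3ZdLettersOmega.norm_restrictDom_le _ A' y τ).trans (hAglob y τ)
  obtain ⟨a, ha_def⟩ : ∃ a : ℝ,
      a = msup L m i.η (-(1 : ℝ)) (fun j (b : Site d × Fin d) => SideTouches (i.Ω j) b.1 b.2) (fun b => Ain b.1 b.2) := ⟨_, rfl⟩
  have ha0 : 0 ≤ a := by rw [ha_def]; exact B8ScaledSupNorm.msup_nonneg L m hη.le _ _ _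
  -- the collar functional Φ₀ and the pointwise control of the outer part
  obtain ⟨Φ, hΦ_def⟩ : ∃ Φ : ℝ, Φ = msup L m i.η (-(1 : ℝ))
      (fun j (b : Site d × Fin d) => j = 0 ∧ SideTouches (i.Ω 0) b.1 b.2 ∧ ¬ BondTouches (i.Ω 0) b.1 b.2) (fun b => A' b.1 b.2) := ⟨_, rfl⟩
  have hΦ0 : 0 ≤ Φ := by rw [hΦ_def]; exact B8ScaledSupNorm.msup_nonneg L m hη.le _ _ _
  have hbdΦ : Bdd L m i.η (-(1 : ℝ))
      (fun j (b : Site d × Fin d) => j = 0 ∧ SideTouches (i.Ω 0) b.1 b.2 ∧ ¬ BondTouches (i.Ω 0) b.1 b.2) (fun b => A' b.1 b.2) := by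
    have e1 : (-(1 : ℝ)) = -((1 : ℕ) : ℝ) := by norm_num
    rw [e1]
    exact B9SupplySockB9P3ZdLettersOmega.bdd_neg_of_pointwise hL hη 1 fun b => hAglob b.1 b.2
  have hout : ∀ (y : Site d) (τ : Fin d), ‖outerPart (i.Ω 0) A' y τ‖ ≤ i.η⁻¹ * Φ := by
    intro y τ; rw [hΦ_def]
    exact B9SupplySockB9P3ZdLettersOmega.norm_outerPart_le_phi hη hMi hA0 hbdΦ y τ
  -- the Landau condition for A′, hence for 𝟙_{Ω₀}A′; the source J̃ = Δ_a(U₀)𝟙_{Ω₀}A′ and 𝟙_{Ω₀}A′ = G(U₀)J̃ ((1.58))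
  have hLanA : IsLandau138 L m i.η (i.Ω 0) (i.Λs m) U₀ A' :=
    B9SupplySockB9P3Zd.landau_of_landauW hd2 hη U₀ hWu hα₂16 h41 hLanW
  have hLanAin : IsLandau138 L m i.η (i.Ω 0) (i.Λs m) U₀ Ain := by
    rw [hAin_def]; exact (B9SupplySockB9P3ZdLettersOmega.isLandau138_restrictDom_iff L m i.η (i.Ω 0) (i.Λs m) U₀ A').2 hLanA
  obtain ⟨Jt, hJt_def⟩ : ∃ Jt : Site d → Fin d → 𝔸, Jt = deltaAOf i.η (ops M i m) U₀ Ain := ⟨_, rfl⟩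
  have hGJ : (ops M i m).Gop U₀ Jt = Ain :=
    hinv α₀ U₀ hU₀ hα₀I hInA Ain hOn (fun y τ => by rw [hAin_def]; exact isSelfAdjoint_restrictDom hsa y τ) Jt
      fun y τ _ => by rw [hJt_def]
  have hDRD : ∀ (x : Site d) (μ : Fin d), (ops M i m).DRDs U₀ Ain x μ = 0 :=
    hlan (K₆ * α₀) U₀ hU₀ ha₉0 ha3' hreg Ain hOn hLanAin
  have hJtb : ∀ (x : Site d) (μ : Fin d),
      Jt x μ = Jcur i.η U₀ Ain μ x + (ops M i m).Dp U₀ Ain x μ + (ops M i m).DRDs U₀ Ain x μ + (ops M i m).QQ U₀ Ain x μ := by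
    intro x μ; rw [hJt_def]; rfl
  -- the right-hand side quantities: |J|₍₋₃₎ of the datum, |J(𝟙_{Ω₀}A′)|₍₋₃₎, |B₁|
  obtain ⟨nJ, hnJ_def⟩ : ∃ nJ : ℝ, nJ = bondNorm L m i.η (-(3 : ℝ)) i.Ω (fun x μ => Jcur i.η U₀ A' μ x) := ⟨_, rfl⟩
  obtain ⟨nJi, hnJi_def⟩ : ∃ nJi : ℝ, nJi = bondNorm L m i.η (-(3 : ℝ)) i.Ω (fun x μ => Jcur i.η U₀ Ain μ x) := ⟨_, rfl⟩
  obtain ⟨nB, hnB_def⟩ : ∃ nB : ℝ, nB = wsup 1 (fun p : {p : ℕ × (Site d × Fin d) // p.1 ≤ m ∧ (p.2 ∈ ΛbP m p.1 ∨ (p.1 = 0 ∧ CrossB (i.Ω 0) p.2))} =>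
      linCovIter L U₀ (iEta i.η A') p.1.1 p.1.2.1 p.1.2.2) := ⟨_, rfl⟩
  have hnJ0 : 0 ≤ nJ := by rw [hnJ_def]; exact B8ScaledSupNorm.msup_nonneg L m hη.le _ _ _
  have hnB0 : 0 ≤ nB := by rw [hnB_def]; exact B8Eq155JBound.wsup_nonneg zero_le_one _
  have hnB_eq : wsup 1 (fun p : {p : ℕ × (Site d × Fin d) // p.1 ≤ m ∧ (p.2 ∈ ΛbP m p.1 ∨ (p.1 = 0 ∧ CrossB (i.Ω 0) p.2))} =>
      linCovIter L U₀ (iEta i.η Ain) p.1.1 p.1.2.1 p.1.2.2) = nB := by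
    rw [hnB_def, hAin_def]
    exact wsupB1γ_restrictDom hL m i.η hsee U₀ A'
  -- |J(𝟙_{Ω₀}A′)|₍₋₃₎ ≤ |J(A′)|₍₋₃₎ + 16dΦ (the outer part sits at level 0)
  have hnJi_le : nJi ≤ nJ + 16 * d * Φ := by
    rw [hnJi_def, hnJ_def, hAin_def]
    exact B9SupplySockB9P3ZdLettersOmega.bondNorm_jcur_restrict_le hL hη hMi hU₀1 hΦ0 hout hAglob
  -- the current of 𝟙_{Ω₀}A′ is bounded
  have hgrad : ∀ (y : Site d) (κ τ : Fin d), ‖covDerivFwd i.η U₀ κ (fun z => Ain z τ) y‖ ≤ i.η⁻¹ * (α₂ * i.η⁻¹ + α₂ * i.η⁻¹) :=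
    fun y κ τ => (B9SupplySockB9P3ZdLettersOmega.norm_covDerivFwd_le hη (hU₀1 _ _) _).trans
      (mul_le_mul_of_nonneg_left (add_le_add (hAin_glob _ _) (hAin_glob _ _)) (inv_nonneg.mpr hη.le))
  have hJbd : Bdd L m i.η (-(3 : ℝ)) (fun j (b : Site d × Fin d) => BondTouches (i.Ω j) b.1 b.2)
      (fun b => Jcur i.η U₀ Ain b.2 b.1) :=
    B9SupplySockB9P3Zd.bdd_neg_three_of_pointwise hL hη fun b => B9SupplySockB9P3Zd.norm_Jcur_le_of_grad hη hU₀1 hgrad b.2 b.1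
  -- |J̃|₍₋₃₎ ≤ |J(𝟙_{Ω₀}A′)|₍₋₃₎ + c₆₉ M α₀ |𝟙_{Ω₀}A′|₍₋₁₎ + q |B₁| (pointwise: (3.26) with (3.69), the Landau condition, (3.16))
  have hJt : bondNorm L m i.η (-(3 : ℝ)) i.Ω Jt ≤ nJi + c69 * M * α₀ * a + q * nB := by
    have e3 : (-(3 : ℝ)) = -((3 : ℕ) : ℝ) := by norm_num
    have hnJi0 : 0 ≤ nJi := by rw [hnJi_def]; exact B8ScaledSupNorm.msup_nonneg L m hη.le _ _ _
    refine B8ScaledSupNorm.msup_le (by positivity) fun j hj b hb => ?_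
    have hw : weight L i.η (-(3 : ℝ)) j = ((L : ℝ) ^ j * i.η) ^ 3 := by
      rw [e3, B8ScaledSupNorm.weight_neg_natCast]
    have hw0 : 0 ≤ ((L : ℝ) ^ j * i.η) ^ 3 := by positivity
    have h1 : weight L i.η (-(3 : ℝ)) j * ‖Jcur i.η U₀ Ain b.2 b.1‖ ≤ nJi := by
      rw [hnJi_def]; exact B8ScaledSupNorm.weight_mul_norm_le_msup hJbd hj hb
    have h2 : ((L : ℝ) ^ j * i.η) ^ 3 * ‖(ops M i m).Dp U₀ Ain b.1 b.2‖ ≤ c69 * M * α₀ * a := by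
      rw [ha_def]; exact hcurv α₀ U₀ hU₀ hα₀ hInA Ain hOn j hj b.1 b.2 hb
    have h4 : ((L : ℝ) ^ j * i.η) ^ 3 * ‖(ops M i m).QQ U₀ Ain b.1 b.2‖ ≤ q * nB := by
      rw [← hnB_eq]; exact havg U₀ hU₀ Ain hOn j hj b.1 b.2 hb
    have hsum : ‖Jt b.1 b.2‖ ≤
        ‖Jcur i.η U₀ Ain b.2 b.1‖ + ‖(ops M i m).Dp U₀ Ain b.1 b.2‖ + ‖(ops M i m).QQ U₀ Ain b.1 b.2‖ := by
      rw [hJtb, hDRD b.1 b.2, add_zero]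
      exact norm_add₃_le
    rw [hw] at h1 ⊢
    calc ((L : ℝ) ^ j * i.η) ^ 3 * ‖Jt b.1 b.2‖
        ≤ ((L : ℝ) ^ j * i.η) ^ 3 *
            (‖Jcur i.η U₀ Ain b.2 b.1‖ + ‖(ops M i m).Dp U₀ Ain b.1 b.2‖ + ‖(ops M i m).QQ U₀ Ain b.1 b.2‖) :=
          mul_le_mul_of_nonneg_left hsum hw0
      _ = ((L : ℝ) ^ j * i.η) ^ 3 * ‖Jcur i.η U₀ Ain b.2 b.1‖ + ((L : ℝ) ^ j * i.η) ^ 3 * ‖(ops M i m).Dp U₀ Ain b.1 b.2‖ +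
            ((L : ℝ) ^ j * i.η) ^ 3 * ‖(ops M i m).QQ U₀ Ain b.1 b.2‖ := by ring
      _ ≤ nJi + c69 * M * α₀ * a + q * nB := add_le_add (add_le_add h1 h2) h4
  -- Theorem 3.3's γ = −3 entries at J̃ through the dictionary ((3.47) ⇒ (1.59) for 𝟙_{Ω₀}A′)
  obtain ⟨hw, hG0, hG1, hG3⟩ := hd U₀ hU₀ Jt
  have hline1 : a ≤ B₀ * bondNorm L m i.η (-(3 : ℝ)) i.Ω Jt := by
    have h := B9.glob_at_minus_three (GA (mem M i m)) h347 0 (ιLoc M i m Jt)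
    rw [hG0, hw, hGJ, ← ha_def] at h
    exact h
  have hline2 : msup L m i.η (-(2 : ℝ)) (fun j (t : Fin d × Fin d × Site d) => SideTouches (i.Ω j) t.2.2 t.2.1)
      (fun t => covDerivFwd i.η U₀ t.1 (fun z => Ain z t.2.1) t.2.2) ≤ B₀ * bondNorm L m i.η (-(3 : ℝ)) i.Ω Jt := by
    have h := B9.glob_at_minus_three (GA (mem M i m)) h347 1 (ιLoc M i m Jt)
    rw [hG1, hw, hGJ] at h
    exact h
  have hline4 : bondNorm L m i.η (-(3 : ℝ)) i.Ω (fun x μ => covLap i.η U₀ (fun z => Ain z μ) x) ≤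
      B₀ * bondNorm L m i.η (-(3 : ℝ)) i.Ω Jt := by
    have h := B9.glob_at_minus_three (GA (mem M i m)) h347 3 (ιLoc M i m Jt)
    rw [hG3, hw, hGJ] at h
    exact h
  -- the a-priori (Neumann) step of G-IF-01 for 𝟙_{Ω₀}A′ with the source norm nJ + 16dΦ
  have hN : bondNorm L m i.η (-(3 : ℝ)) i.Ω Jt ≤ (nJ + 16 * d * Φ) + c69 * M * α₀ * a + q * nB := by
    linarith only [hJt, hnJi_le]
  have hnJ1 : 0 ≤ nJ + 16 * d * Φ := by positivity
  obtain ⟨hA1, hA2, -, hA4, -⟩ := B9SupplySockB9P3Zd.apriori_arith (h := 0) (Cβ := 0) hB₀ hq hκ' hθ ha0 hnJ1 hnB0 le_rfl rfl hN hline1 hline2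
    hline4 (by rw [zero_mul])
  -- bookkeeping constants
  obtain ⟨B', hB'_def⟩ : ∃ B' : ℝ, B' = max 1 (2 * B₀ * max 1 q) := ⟨_, rfl⟩
  have hB'1 : 1 ≤ B' := by rw [hB'_def]; exact le_max_left _ _
  rw [← hB'_def] at hA1 hA2 hA4 ⊢
  -- the four lines for A′ = 𝟙_{Ω₀}A′ + outer part
  have hL1 : msup L m i.η (-(1 : ℝ)) (fun j (b : Site d × Fin d) => SideTouches (i.Ω j) b.1 b.2) (fun b => A' b.1 b.2) ≤ a + Φ := by
    rw [ha_def, hAin_def]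
    exact B9SupplySockB9P3ZdLettersOmega.msup_side_le_restrict_add hη hMi hΦ0 hout hAbd
  have hL2 : msup L m i.η (-(2 : ℝ)) (fun j (t : Fin d × Fin d × Site d) => SideTouches (i.Ω j) t.2.2 t.2.1)
      (fun t => covDerivFwd i.η U₀ t.1 (fun z => A' z t.2.1) t.2.2) ≤
      msup L m i.η (-(2 : ℝ)) (fun j (t : Fin d × Fin d × Site d) => SideTouches (i.Ω j) t.2.2 t.2.1)
        (fun t => covDerivFwd i.η U₀ t.1 (fun z => Ain z t.2.1) t.2.2) + 2 * Φ := by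
    rw [hAin_def]
    exact B9SupplySockB9P3ZdLettersOmega.msup_grad_le_restrict_add hL hη hMi hU₀1 hΦ0 hout hAglob
  have hL4 : bondNorm L m i.η (-(3 : ℝ)) i.Ω (fun x μ => covLap i.η U₀ (fun z => A' z μ) x) ≤
      bondNorm L m i.η (-(3 : ℝ)) i.Ω (fun x μ => covLap i.η U₀ (fun z => Ain z μ) x) + 4 * d * Φ := by
    rw [hAin_def]
    exact B9SupplySockB9P3ZdLettersOmega.bondNorm_covLap_le_restrict_add hL hη hMi hU₀1 hΦ0 hout hAglob
  have hJJ : bondNorm L m i.η (-(3 : ℝ)) i.Ω (fun x μ => pdiv i.η U₀ (plaqCovDeriv i.η U₀ A') μ x) = nJ := by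
    rw [hnJ_def]; rfl
  -- name the remaining large terms, so that the final arithmetic runs on atoms
  obtain ⟨l1, hl1_def⟩ : ∃ l1 : ℝ,
      l1 = msup L m i.η (-(1 : ℝ)) (fun j (b : Site d × Fin d) => SideTouches (i.Ω j) b.1 b.2) (fun b => A' b.1 b.2) := ⟨_, rfl⟩
  obtain ⟨l2, hl2_def⟩ : ∃ l2 : ℝ, l2 = msup L m i.η (-(2 : ℝ)) (fun j (t : Fin d × Fin d × Site d) => SideTouches (i.Ω j) t.2.2 t.2.1)
      (fun t => covDerivFwd i.η U₀ t.1 (fun z => A' z t.2.1) t.2.2) := ⟨_, rfl⟩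
  obtain ⟨g2, hg2_def⟩ : ∃ g2 : ℝ, g2 = msup L m i.η (-(2 : ℝ)) (fun j (t : Fin d × Fin d × Site d) => SideTouches (i.Ω j) t.2.2 t.2.1)
      (fun t => covDerivFwd i.η U₀ t.1 (fun z => Ain z t.2.1) t.2.2) := ⟨_, rfl⟩
  obtain ⟨l4, hl4_def⟩ : ∃ l4 : ℝ, l4 = bondNorm L m i.η (-(3 : ℝ)) i.Ω (fun x μ => covLap i.η U₀ (fun z => A' z μ) x) := ⟨_, rfl⟩
  obtain ⟨g4, hg4_def⟩ : ∃ g4 : ℝ, g4 = bondNorm L m i.η (-(3 : ℝ)) i.Ω (fun x μ => covLap i.η U₀ (fun z => Ain z μ) x) := ⟨_, rfl⟩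
  rw [← hl1_def] at hL1
  rw [← hl2_def, ← hg2_def] at hL2
  rw [← hg2_def] at hA2
  rw [← hl4_def, ← hg4_def] at hL4
  rw [← hg4_def] at hA4
  rw [← hnJ_def, ← hnB_def, ← hΦ_def, hJJ, ← hl1_def, ← hl2_def, ← hl4_def]
  have hd4 : (1 : ℝ) ≤ 4 * d + 2 := by linarith only [hd1]
  refine ⟨?_, ?_, ?_, ?_⟩
  · exact collar_arith (e := 1) hB'1 hΦ0 hd4 (by linarith only [hL1, hA1])
  · exact collar_arith (e := 2) hB'1 hΦ0 (by linarith only [hd1]) (by linarith only [hL2, hA2])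
  · refine collar_arith (e := 0) hB'1 hΦ0 (by linarith only [hd1]) ?_
    have h1 : nJ ≤ B' * nJ := le_mul_of_one_le_left hnJ0 hB'1
    have h2 : 0 ≤ B' * (16 * d * Φ + nB) := by positivity
    calc nJ ≤ B' * nJ := h1
      _ ≤ B' * nJ + B' * (16 * d * Φ + nB) := le_add_of_nonneg_right h2
      _ = B' * (nJ + 16 * d * Φ + nB) + 0 * Φ := by ring
  · exact collar_arith (e := 4 * d) hB'1 hΦ0 (by linarith only [hd1]) (by linarith only [hL4, hA4])


/-- ★ (EDITION H·I — `hinv : InvAtHI`, (3.27) keyed by the DATUM's class (1.7) and fed `hInAk`, `α₀ ≤ aI`; threshold gains the entry `aI`.) **(`CurvAtInAk` currency.)  THEOREM 3.3 (BY NAME) SUPPLIES THE β COLLAR SOCKET AT EVERY MEMBER OF AN INDEX MAP WITH `Margin2`, EVERY TRUNCATION LEVEL `m ≤ k`, AT A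
MEMBER-WISE DATUM CLASS `ΛbP j` READ INSIDE `Ω₀`** (edition γ of `B9SupplySockB9P3ZdBeta.sockB9P3D4β_allLevels_of_thm33_on`: binder `AvgAtγ … (ΛbP j)`,
law `SeesDom` at the levels `m ≤ k`, socket `SockB9P3D4β … (ΛbP j)`; at `ΛbP j :=` print's class this is the edition-γ family supplier). [cite: Balaban1985RegularSpaces, (1.58)–(1.59) p.86, Thm 4 p.88, p.77; Balaban1985BackgroundPropagators, Thm 3.3 p.399, (3.27) p.395] -/
theorem sockB9P3D4γIHI_allLevels_of_thm33_on (hd2 : 2 ≤ d) (hL : 1 ≤ L) {c35 c₆ K₆ M₃ a₃ c69 q : ℝ}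
    {Gp : ∀ i, B9.KernelFamily (geo i) (bg i)} (h33 : B9.Thm33Printed c35 geo bg Gp GA)
    {J : Type*} (ι : J → ZdIdx d L) (hMJ : ∀ j, Margin2 (ι j).Ω)
    (hdict : ∀ (M : ℝ) (j : J) (m : ℕ), DictAt geo bg GA L mem ιCfg ιLoc ops M (ι j) m)
    (hP6 : ∀ (M : ℝ) (j : J) (m : ℕ), M₃ ≤ M → Prop6At bg L mem ιCfg c35 c₆ K₆ M (ι j) m)
    {aI : ℝ} (hinv : ∀ (M : ℝ) (j : J) (m : ℕ), M₃ ≤ M → InvAtHI L ops aI M (ι j) m)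
    (hcurv : ∀ (M : ℝ) (j : J) (m : ℕ), M₃ ≤ M → CurvAtInAk L ops c69 M (ι j) m)
    (hlan : ∀ (M : ℝ) (j : J) (m : ℕ), M₃ ≤ M → LandauAt bg L mem ιCfg ops c35 a₃ M (ι j) m)
    (ΛbP : J → ℕ → ℕ → Set (Site d × Fin d)) (havg : ∀ (M : ℝ) (j : J) (m : ℕ), AvgAtγ L ops q (ΛbP j) M (ι j) m)
    (hsee : ∀ (j : J) (m : ℕ), m ≤ (ι j).k → SeesDom L m ((ι j).Ω 0) (ΛbP j))
    (hc₆ : 0 < c₆) (hK₆ : 0 < K₆) (ha₃ : 0 < a₃) (haI : 0 < aI) (hc69 : 0 ≤ c69) (hq : 0 ≤ q) :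
    ∃ B₀ cP : ℝ, 0 < B₀ ∧ 0 < cP ∧
      ∀ (j : J) (m : ℕ), m ≤ (ι j).k →
        SockB9P3D4β (𝔸 := 𝔸) L (max 1 (2 * B₀ * max 1 q)) ((20 * d + 2) * max 1 (2 * B₀ * max 1 q)) cP
          (ι j).η m (ι j).Ω (ι j).Λs (ΛbP j) := by
  obtain ⟨M₁, δ₀, a₀, B₀, Bβ, Bε, Bεβ, -, -, ha₀, hB₀, H⟩ := h33
  obtain ⟨M, hM_def⟩ : ∃ M : ℝ, M = max 1 (max M₁ M₃) := ⟨_, rfl⟩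
  have hM1 : 1 ≤ M := by rw [hM_def]; exact le_max_left _ _
  have hMM₁ : M₁ ≤ M := by rw [hM_def]; exact (le_max_left _ _).trans (le_max_right _ _)
  have hMM₃ : M₃ ≤ M := by rw [hM_def]; exact (le_max_right _ _).trans (le_max_right _ _)
  have hM0 : 0 < M := lt_of_lt_of_le one_pos hM1
  have hKM : 0 < K₆ * M := mul_pos hK₆ hM0
  refine ⟨B₀, min (1 / 16) (min (c₆ / M) (min (a₀ / (K₆ * M)) (min (a₃ / (K₆ * M)) (min aI (1 / (2 * B₀ * c69 * M + 1)))))),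
    hB₀, ?_, fun j m hm => ?_⟩
  · refine lt_min (by norm_num) (lt_min (div_pos hc₆ hM0) (lt_min (div_pos ha₀ hKM) (lt_min (div_pos ha₃ hKM) (lt_min haI ?_))))
    have : 0 < 2 * B₀ * c69 * M + 1 := by positivity
    positivity
  · refine sockB9P3D4γIHI_at geo bg GA L mem ιCfg ιLoc ops hd2 hL hM1 (ι j) (hMJ j) (hdict M j m) (hP6 M j m hMM₃) (hinv M j m hMM₃)
      (hcurv M j m hMM₃) (hlan M j m hMM₃) (ΛbP j) (havg M j m) (hsee j m hm) hK₆ hc69 hq (δ₀ := δ₀) hB₀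
      fun α₀ U₀ hU₀ hα₀ hMa hreg => ?_
    have hMi : M₁ ≤ (geo (mem M (ι j) m)).M := by rw [(hdict M j m).1]; exact hMM₁
    have hMa' : (geo (mem M (ι j) m)).M * α₀ ≤ a₀ := by rw [(hdict M j m).1]; exact hMa
    exact (H (mem M (ι j) m) hMi α₀ hα₀ hMa' (ιCfg M (ι j) m U₀ hU₀) hreg).2.1

/-- ★ (EDITION H·I — `hinv : InvAtHI`, (3.27) keyed by the DATUM's class (1.7) and fed `hInAk`, `α₀ ≤ aI`; threshold gains the entry `aI`.) **(`CurvAtInAk` currency; EXPLICIT CONSTANTS.)  THE β COLLAR SOCKET FAMILY AT A MEMBER-WISE DATUM CLASS FROM THEOREM 3.3's `G(U)`-BLOCK AT NAMED CONSTANTS**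
(edition γ of `B9SupplySockB9P3ZdBeta.sockB9P3D4β_allLevels_explicit_on`). [cite: Balaban1985RegularSpaces, (1.59) p.86, Thm 4 p.88, p.77; Balaban1985BackgroundPropagators, Thm 3.3 p.399] -/
theorem sockB9P3D4γIHI_allLevels_explicit_on (hd2 : 2 ≤ d) (hL : 1 ≤ L) {c35 c₆ K₆ M₃ a₃ c69 q : ℝ}
    {M₁ δ₀ a₀ B₀ : ℝ} {Bβ Bε : ℝ → ℝ} {Bεβ : ℝ → ℝ → ℝ} (hB₀ : 0 < B₀)
    (H : ∀ i : I, M₁ ≤ (geo i).M → ∀ α₀ : ℝ, 0 < α₀ → (geo i).M * α₀ ≤ a₀ →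
      ∀ U : (bg i).Cfg, (bg i).Reg335 c35 α₀ U →
        B9.Ineq342_346_347 (GA i) B₀ δ₀ U ∧ B9.Ineq343_345 (GA i) Bβ Bε Bεβ δ₀ U)
    {M : ℝ} (hM1 : 1 ≤ M) (hMM₁ : M₁ ≤ M) (hMM₃ : M₃ ≤ M)
    {J : Type*} (ι : J → ZdIdx d L) (hMJ : ∀ j, Margin2 (ι j).Ω)
    (hdict : ∀ (M : ℝ) (j : J) (m : ℕ), DictAt geo bg GA L mem ιCfg ιLoc ops M (ι j) m)
    (hP6 : ∀ (M : ℝ) (j : J) (m : ℕ), M₃ ≤ M → Prop6At bg L mem ιCfg c35 c₆ K₆ M (ι j) m)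
    {aI : ℝ} (hinv : ∀ (M : ℝ) (j : J) (m : ℕ), M₃ ≤ M → InvAtHI L ops aI M (ι j) m)
    (hcurv : ∀ (M : ℝ) (j : J) (m : ℕ), M₃ ≤ M → CurvAtInAk L ops c69 M (ι j) m)
    (hlan : ∀ (M : ℝ) (j : J) (m : ℕ), M₃ ≤ M → LandauAt bg L mem ιCfg ops c35 a₃ M (ι j) m)
    (ΛbP : J → ℕ → ℕ → Set (Site d × Fin d)) (havg : ∀ (M : ℝ) (j : J) (m : ℕ), AvgAtγ L ops q (ΛbP j) M (ι j) m)
    (hsee : ∀ (j : J) (m : ℕ), m ≤ (ι j).k → SeesDom L m ((ι j).Ω 0) (ΛbP j))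
    (hK₆ : 0 < K₆) (hc69 : 0 ≤ c69) (hq : 0 ≤ q) :
    ∀ (j : J) (m : ℕ), m ≤ (ι j).k →
      SockB9P3D4β (𝔸 := 𝔸) L (max 1 (2 * B₀ * max 1 q)) ((20 * d + 2) * max 1 (2 * B₀ * max 1 q))
        (min (1 / 16) (min (c₆ / M) (min (a₀ / (K₆ * M)) (min (a₃ / (K₆ * M)) (min aI (1 / (2 * B₀ * c69 * M + 1)))))))
        (ι j).η m (ι j).Ω (ι j).Λs (ΛbP j) := by
  intro j m hm
  refine sockB9P3D4γIHI_at geo bg GA L mem ιCfg ιLoc ops hd2 hL hM1 (ι j) (hMJ j) (hdict M j m) (hP6 M j m hMM₃) (hinv M j m hMM₃)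
    (hcurv M j m hMM₃) (hlan M j m hMM₃) (ΛbP j) (havg M j m) (hsee j m hm) hK₆ hc69 hq (δ₀ := δ₀) hB₀
    fun α₀ U₀ hU₀ hα₀ hMa hreg => ?_
  have hMi : M₁ ≤ (geo (mem M (ι j) m)).M := by rw [(hdict M j m).1]; exact hMM₁
  have hMa' : (geo (mem M (ι j) m)).M * α₀ ≤ a₀ := by rw [(hdict M j m).1]; exact hMa
  exact (H (mem M (ι j) m) hMi α₀ hα₀ hMa' (ιCfg M (ι j) m U₀ hU₀) hreg).1


end SupplyCubeI

end Literature.MathematicalPhysics.QuantumFieldTheory.Balaban1983to89.B9SupplySockB9P3ZdAtHermInAk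

end
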